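import Summits.Ventures.PercRepro.RankLevelSetLevelSixHeavyCell

/-!
# PercRepro — the rank-`≤ 6` sets are the small sets plus the rank-`6` sets (p8 g3, S3)

`proofs/SUBCLAIM-S3-p8.md` §3o. For the U-COUNT TAIL: `#{r ≤ 6} ≤ Σ_{j ≤ f} C(n, j) + #{r = 6}` when every rank-`≤ 5`
set has `≤ f` points (on the core `f = min 19 (5 + d)`); the rank-`6` sets are then counted by the heavy / light count
(`ncard_eRk_eq_ncard_le_le_heavy_sq` with the size cap `min 39 (6 + d)`). Axioms: standard.
-/

open scoped Matroid

namespace PercRepro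

namespace ThmN

open Set

variable {α : Type}

/-- `#{r ≤ 6} ≤ Σ_{j ≤ f} C(|E|, j) + #{r = 6}` when every rank-`≤ 5` set has `≤ f` points. -/
theorem ncard_eRk_le_six_le_small_add (M : Matroid α) [M.Finite] {f : ℕ}
    (hflat' : ∀ X ⊆ M.E, M.eRk X ≤ ((6 - 1 : ℕ) : ℕ∞) → X.ncard ≤ f) :
    {X : Set α | X ⊆ M.E ∧ M.eRk X ≤ 6}.ncard ≤
      ∑ j ∈ Finset.range (f + 1), M.ground_finite.toFinset.card.choose j +
        {X : Set α | X ⊆ M.E ∧ M.eRk X = 6}.ncard := by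
  classical
  have hsub : {X : Set α | X ⊆ M.E ∧ M.eRk X ≤ 6} ⊆
      {X : Set α | X ⊆ (M.ground_finite.toFinset : Set α) ∧ X.ncard ≤ f} ∪
        {X : Set α | X ⊆ M.E ∧ M.eRk X = 6} := by
    intro X hX
    rcases eq_or_ne (M.eRk X) 6 with h6 | h6
    · exact Or.inr ⟨hX.1, h6⟩
    · left
      refine ⟨by rw [Set.Finite.coe_toFinset]; exact hX.1, ?_⟩
      have hlt : M.eRk X < 6 := lt_of_le_of_ne hX.2 h6
      have h5 : M.eRk X ≤ ((6 - 1 : ℕ) : ℕ∞) := by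
        have h51 : (6 : ℕ∞) = (5 : ℕ∞) + 1 := by norm_num
        rw [h51, ENat.lt_add_one_iff (by simp)] at hlt
        simpa using hlt
      exact hflat' X hX.1 h5
  have hfin1 : {X : Set α | X ⊆ (M.ground_finite.toFinset : Set α) ∧ X.ncard ≤ f}.Finite :=
    (Finset.finite_toSet _).finite_subsets.subset (fun X hX => hX.1)
  have hfin2 : {X : Set α | X ⊆ M.E ∧ M.eRk X = 6}.Finite :=
    M.ground_finite.finite_subsets.subset (fun X hX => hX.1)
  calc {X : Set α | X ⊆ M.E ∧ M.eRk X ≤ 6}.ncard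
      ≤ ({X : Set α | X ⊆ (M.ground_finite.toFinset : Set α) ∧ X.ncard ≤ f} ∪
          {X : Set α | X ⊆ M.E ∧ M.eRk X = 6}).ncard := ncard_le_ncard hsub (hfin1.union hfin2)
    _ ≤ {X : Set α | X ⊆ (M.ground_finite.toFinset : Set α) ∧ X.ncard ≤ f}.ncard +
          {X : Set α | X ⊆ M.E ∧ M.eRk X = 6}.ncard := ncard_union_le _ _
    _ ≤ ∑ j ∈ Finset.range (f + 1), M.ground_finite.toFinset.card.choose j +
          {X : Set α | X ⊆ M.E ∧ M.eRk X = 6}.ncard := by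
        gcongr
        exact ncard_subsets_ncard_le _ f

end ThmN

end PercRepro
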